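import Literature.Geometry.Lorentzian.ChartScalarCurvature
import Literature.Geometry.Lorentzian.MetricNormSq
import Literature.Geometry.Lorentzian.VolumePositivity
import Literature.Geometry.Lorentzian.InitialData
import Literature.Geometry.Lorentzian.Basic
import HarnessLib

/-!
# The square norm `‖Ric‖²_g` of the Ricci tensor: frame formula, smoothness, positivity of its integral

Support file (all results proved, no named facts) for step 2 of Schoen–Yau's positive mass
rigidity (Comm. Math. Phys. 65 (1979), §3, (3.24)–(3.30); `RicciVariationEllipticSteps.lean`,
`PositiveMassRigidity.lean`): the last inference of the printed proof, *"If `Ric` is not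
identically zero, (3.30) implies that `M'(0) > 0`"* (p. 74, with (3.30)
`M'(0) = c ∫_N ‖Ric‖² dx`, `c > 0`), is the positivity of `∫ ‖Ric‖²_h dV_h` for `Ric ≢ 0`. It is
proved here (`integral_normSq_ricci_pos`) and consumed by the reduction of that step to the
elliptic steps of the printed proof (`exists_ricciVariation_negativeMass_of_massZero_of_elliptic_steps`,
`RicciVariationEllipticSteps.lean`), from:

* `PseudoRiemannianMetric.normSq_eq_sum_gram_inv` — **the metric square norm in a basis** of a
  fibre: `|T|²_g = ∑ᵢⱼ (𝒢⁻¹)ⱼᵢ ∑ₐ (∑_c (𝒢⁻¹)_{ca} T(β_c, βᵢ)) T(βₐ, βⱼ)` (`= g^{ca} g^{ij} T_{ci} T_{aj}`,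
  O'Neill 1983, Ch. 3, pp. 60–61), `𝒢` the Gram matrix (pure linear algebra, any signature, any
  vector bundle; companion of `trace_eq_sum_gram_inv` of `CurvatureRegularity.lean`);
* `contMDiffOn_normSq_ricci_baseSet`, `contMDiff_normSq_ricci`,
  `PseudoRiemannianMetric.IsLeviCivita.contMDiff_normSq_ricci`,
  `PseudoRiemannianMetric.contMDiff_normSq_ricci'` — **`x ↦ |Ric_x|²_g` is `C^∞`** for a `C^∞`
  metric and a covariant derivative on `TM` locally `C¹` and `C^∞` (in particular its Levi-Civita
  connection): in the local frame of a trivialization the frame formula is a finite sum of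
  products of smooth inverse-Gram entries and smooth Ricci components (the pattern of
  `contMDiffOn_trace_ricci_baseSet`, `CurvatureRegularity.lean`);
* `integral_normSq_ricci_pos` — for Riemannian data `D = (h, k)` on a `3`-manifold with
  `‖Ric‖²_h ∈ L¹(dV_h)` and `Ric ≢ 0`: `0 < ∫_X ‖Ric‖²_h dV_h` (`‖Ric‖²_h ≥ 0` with equality iff
  `Ric = 0`, `MetricNormSq.lean`; the Riemannian measure charges nonempty open sets,
  `isOpenPosMeasure_riemannianMeasure`, `VolumePositivity.lean`).

## References

* B. O'Neill, *Semi-Riemannian geometry with applications to relativity*, Academic Press 1983,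
  Ch. 3, Def. 3.51 (`Ric ∈ 𝔗⁰₂(M)`), pp. 60–61 (metric contraction in a frame).
* R. Schoen, S.-T. Yau, *On the proof of the positive mass conjecture in general relativity*,
  Comm. Math. Phys. 65 (1979) 45–76, §3, p. 74, (3.30).
-/

noncomputable section

open Bundle Set Function Filter TopologicalSpace MeasureTheory
open scoped Manifold ContDiff Topology

namespace Literature.Geometry.Lorentzian

/-! ### The metric square norm in a basis of a fibre -/

section Fibre

variable {EB : Type*} [NormedAddCommGroup EB] [NormedSpace ℝ EB]
  {HB : Type*} [TopologicalSpace HB] {B : Type*} [TopologicalSpace B] [ChartedSpace HB B]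
  {IB : ModelWithCorners ℝ EB HB} {n' : ℕ∞ω}
  {F' : Type*} [NormedAddCommGroup F'] [NormedSpace ℝ F'] {V : B → Type*}
  [TopologicalSpace (TotalSpace F' V)] [∀ b, TopologicalSpace (V b)] [∀ b, AddCommGroup (V b)]
  [∀ b, Module ℝ (V b)] [FiberBundle F' V] [VectorBundle ℝ F' V] [FiniteDimensional ℝ F']
  {ι : Type*} [Fintype ι] [DecidableEq ι]

/-- **The metric square norm in a basis**: `|T|²_g = ∑ᵢⱼ (𝒢⁻¹)ⱼᵢ ∑ₐ (∑_c (𝒢⁻¹)_{ca} T(β_c, βᵢ)) T(βₐ, βⱼ)`,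
i.e. `T_{ci} T_{aj} g^{ca} g^{ij}` with `𝒢` the Gram matrix of the basis `β` (O'Neill 1983, Ch. 3,
pp. 60–61, metric contraction; the tree's `g.normSq` is `tr ((♯ ∘ T) ∘ (♯ ∘ Tᵗ))`, expanded by
`trace_eq_sum_gram_inv_val` and `sharp_eq_sum`). [cite: ONeill1983, Ch. 3, pp. 60–61] -/
theorem PseudoRiemannianMetric.normSq_eq_sum_gram_inv (g' : PseudoRiemannianMetric IB n' F' V)
    (b : B) (β : Module.Basis ι ℝ (V b)) (T : LinearMap.BilinForm ℝ (V b)) :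
    g'.normSq b T = ∑ i, ∑ j, (Matrix.of fun i j ↦ g'.val b (β i) (β j))⁻¹ j i *
      ∑ a, (∑ c, (Matrix.of fun i j ↦ g'.val b (β i) (β j))⁻¹ c a * T (β c) (β i)) *
        T (β a) (β j) := by
  rw [PseudoRiemannianMetric.normSq, trace_eq_sum_gram_inv_val g' b β]
  refine Finset.sum_congr rfl fun i _ ↦ Finset.sum_congr rfl fun j _ ↦ ?_
  congr 1
  simp only [LinearMap.comp_apply, LinearEquiv.coe_coe]
  rw [g'.val_sharp_apply, sharp_eq_sum g' b β (T.flip (β i)), map_sum, LinearMap.sum_apply]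
  refine Finset.sum_congr rfl fun a _ ↦ ?_
  rw [map_smul, LinearMap.smul_apply, smul_eq_mul]
  rfl

end Fibre

/-! ### Smoothness of `‖Ric‖²` -/

section Frame

variable {E : Type*} [NormedAddCommGroup E] [NormedSpace ℝ E] {H : Type*} [TopologicalSpace H]
  {I : ModelWithCorners ℝ E H} {M : Type*} [TopologicalSpace M] [ChartedSpace H M]
  [IsManifold I ∞ M] {cov : CovariantDerivative I E (TangentSpace I : M → Type _)}
  [FiniteDimensional ℝ E] [CompleteSpace E]
  (e : Trivialization E (TotalSpace.proj : TangentBundle I M → M)) [MemTrivializationAtlas e]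
  (g : PseudoRiemannianMetric I ∞ E (TangentSpace I : M → Type _))

/-- **The square norm of the Ricci tensor is smooth, locally** (O'Neill 1983, Ch. 3, Def. 3.51
with pp. 60–61: `Ric ∈ 𝔗⁰₂(M)` and metric contractions of tensor fields are smooth functions): on
the base set of a trivialization of the atlas, `|Ric(cov)_x|²_g` is the frame expression of
`PseudoRiemannianMetric.normSq_eq_sum_gram_inv` in the local frame `sᵢ`, a finite sum of products
of the `C^∞` functions `(G(x)⁻¹)ᵢⱼ` (`contMDiffOn_gram_localFrame_inv`) and `Ric_x(sᵢ x, sⱼ x)`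
(`contMDiffOn_ricci_apply`), for `cov` locally `C¹` and locally `C^∞`.
[cite: ONeill1983, Ch. 3, Def. 3.51 and pp. 60–61] -/
theorem contMDiffOn_normSq_ricci_baseSet (h1 : cov.IsLocallyContMDiff 1)
    (hinf : cov.IsLocallyContMDiff (⊤ : ℕ∞)) :
    CMDiff[e.baseSet] ∞ (fun x ↦ g.normSq x (cov.ricci x)) := by
  classical
  set bE := Module.finBasis ℝ E with hbE
  set Gi : M → Matrix (Fin (Module.finrank ℝ E)) (Fin (Module.finrank ℝ E)) ℝ := fun x ↦
    (Matrix.of fun i j ↦ g.val x (e.localFrame bE i x) (e.localFrame bE j x))⁻¹ with hGi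
  set Rc : Fin (Module.finrank ℝ E) → Fin (Module.finrank ℝ E) → M → ℝ := fun i j x ↦
    cov.ricci x (e.localFrame bE i x) (e.localFrame bE j x) with hRc
  have hGi_smooth : ∀ i j, CMDiff[e.baseSet] ∞ (fun x ↦ Gi x i j) := fun i j ↦
    contMDiffOn_gram_localFrame_inv e g bE i j
  have hRc_smooth : ∀ i j, CMDiff[e.baseSet] ∞ (Rc i j) := fun i j ↦
    contMDiffOn_ricci_apply e h1 hinf (e.contMDiffOn_localFrame_baseSet (I := I) ∞ bE i)
      (e.contMDiffOn_localFrame_baseSet (I := I) ∞ bE j)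
  have formula : ∀ x ∈ e.baseSet, g.normSq x (cov.ricci x) =
      ∑ i, ∑ j, Gi x j i * ∑ a, (∑ c, Gi x c a * Rc c i x) * Rc a j x := by
    intro x hx
    rw [g.normSq_eq_sum_gram_inv x (e.basisAt bE hx)]
    simp only [hGi, hRc, e.localFrame_apply_of_mem_baseSet bE hx]
  have hrhs : CMDiff[e.baseSet] ∞ (fun x ↦
      ∑ i, ∑ j, Gi x j i * ∑ a, (∑ c, Gi x c a * Rc c i x) * Rc a j x) := by
    intro x hx
    have hG' := fun i j ↦ (hGi_smooth i j x hx).contMDiffAt (e.open_baseSet.mem_nhds hx)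
    have hR' := fun i j ↦ (hRc_smooth i j x hx).contMDiffAt (e.open_baseSet.mem_nhds hx)
    refine (contMDiffAt_finsetSum fun i _ ↦ contMDiffAt_finsetSum fun j _ ↦ ?_).contMDiffWithinAt
    refine (hG' j i).mul (contMDiffAt_finsetSum fun a _ ↦ ?_)
    exact (contMDiffAt_finsetSum fun c _ ↦ (hG' c a).mul (hR' c i)).mul (hR' a j)
  exact hrhs.congr formula

/-- **`x ↦ |Ric(cov)_x|²_g` is `C^∞`** for a `C^∞` metric `g` and a covariant derivative `cov` on
`TM` which is locally `C¹` and locally `C^∞` (O'Neill 1983, Ch. 3, Def. 3.51 and pp. 60–61),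
from `contMDiffOn_normSq_ricci_baseSet` at the trivialization at each point.
[cite: ONeill1983, Ch. 3, Def. 3.51 and pp. 60–61] -/
theorem contMDiff_normSq_ricci (h1 : cov.IsLocallyContMDiff 1)
    (hinf : cov.IsLocallyContMDiff (⊤ : ℕ∞)) : CMDiff ∞ (fun x ↦ g.normSq x (cov.ricci x)) := by
  intro x₀
  have hx₀ := mem_baseSet_trivializationAt E (TangentSpace I : M → Type _) x₀
  exact (contMDiffOn_normSq_ricci_baseSet (trivializationAt E (TangentSpace I : M → Type _) x₀)
    g h1 hinf x₀ hx₀).contMDiffAt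
    ((trivializationAt E (TangentSpace I : M → Type _) x₀).open_baseSet.mem_nhds hx₀)

namespace PseudoRiemannianMetric

variable {g}

/-- `x ↦ |Ric(cov)_x|²_g` is `C^∞` for any Levi-Civita connection `cov` of the `C^∞` metric `g`
(such a `cov` is locally `C¹` and locally `C^∞`, `IsLeviCivita.isLocallyContMDiff`). O'Neill
1983, Ch. 3, Def. 3.51 and pp. 60–61. [cite: ONeill1983, Ch. 3, Def. 3.51 and pp. 60–61] -/
theorem IsLeviCivita.contMDiff_normSq_ricci (h : g.IsLeviCivita cov) :
    CMDiff ∞ (fun x ↦ g.normSq x (cov.ricci x)) :=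
  Lorentzian.contMDiff_normSq_ricci g (h.isLocallyContMDiff_one (WithTop.coe_le_coe.mpr le_top))
    (h.isLocallyContMDiff ⊤ (le_of_eq rfl))

variable (g) [g.HasLeviCivita]

/-- **The square norm `‖Ric‖²_g` of the Ricci tensor of a `C^∞` metric is a `C^∞` function**
(O'Neill 1983, Ch. 3, Def. 3.51: `Ric ∈ 𝔗⁰₂(M)`; pp. 60–61: metric contraction).
[cite: ONeill1983, Ch. 3, Def. 3.51 and pp. 60–61] -/
theorem contMDiff_normSq_ricci' : CMDiff ∞ (fun x ↦ g.normSq x (g.ricci x)) :=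
  (isLeviCivita_leviCivita_holds (g := g)).contMDiff_normSq_ricci

end PseudoRiemannianMetric

end Frame

/-! ### Positivity of `∫ ‖Ric‖² dV` -/

/-- **`∫_X ‖Ric‖²_h dV_h > 0` unless `Ric ≡ 0`** — the inference *"If `Ric` is not identically
zero, (3.30) implies that `M'(0) > 0`"* of Schoen–Yau, Comm. Math. Phys. 65 (1979), p. 74, where
(3.30) is `M'(0) = c ∫_N ‖Ric‖² dx`, `c > 0`: for Riemannian data `D = (h, k)` on a `3`-manifold,
if `‖Ric(h)‖²_h` is integrable for the Riemannian measure and `Ric(h) ≢ 0`, then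
`0 < ∫_X ‖Ric‖²_h dV_h`. Proof: `‖Ric‖²_h` is continuous
(`PseudoRiemannianMetric.contMDiff_normSq_ricci'`), nonnegative and positive exactly where
`Ric ≠ 0` (`PseudoRiemannianMetric.normSq_nonneg`, `normSq_eq_zero_iff`, `MetricNormSq.lean`),
so its support is a nonempty open set, of positive Riemannian measure
(`isOpenPosMeasure_riemannianMeasure`, `VolumePositivity.lean`). Consumed by
`exists_ricciVariation_massFunctionAt_of_elliptic_steps` (`RicciVariationEllipticSteps.lean`).
[cite: SchoenYauPMT1979, §3 p. 74, (3.30)] -/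
theorem integral_normSq_ricci_pos {X : Type} [TopologicalSpace X] [ChartedSpace E3 X]
    [IsManifold (𝓡 3) ∞ X] [T2Space X] [LocallyCompactSpace X] [MeasurableSpace X]
    [BorelSpace X] (D : InitialDataSet (𝓡 3) X) [D.metric.HasLeviCivita]
    (hint : Integrable (fun x ↦ D.metric.normSq x (D.metric.ricci x)) (riemannianMeasure D.h))
    (hne : ∃ x : X, D.metric.ricci x ≠ 0) :
    0 < ∫ x, D.metric.normSq x (D.metric.ricci x) ∂(riemannianMeasure D.h) := by
  haveI := isOpenPosMeasure_riemannianMeasure (I := 𝓡 3) D.h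
  rw [integral_pos_iff_support_of_nonneg
    (fun x ↦ D.metric.normSq_nonneg x D.isRiemannian_metric (D.metric.ricci x)) hint]
  obtain ⟨x₀, hx₀⟩ := hne
  refine (isOpen_ne_fun (D.metric.contMDiff_normSq_ricci').continuous continuous_const).measure_pos
    _ ⟨x₀, ?_⟩
  rw [Set.mem_setOf_eq, Ne, D.metric.normSq_eq_zero_iff x₀ D.isRiemannian_metric]
  exact hx₀

end Literature.Geometry.Lorentzian

end
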